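import Literature.AlgebraicGeometry.Motives.HodgeSheaves
import Literature.AlgebraicGeometry.Motives.DifferentialsLocallyFreeProofs
import Mathlib.LinearAlgebra.ExteriorPower.Basis
import Mathlib.RingTheory.Localization.BaseChange
import Mathlib.LinearAlgebra.TensorProduct.Basis
import HarnessLib

/-!
# Discharged fact: `Ωᵃ_{X/k}` is locally free of rank `C(d, a)` for `X/k` smooth of relative dimension `d`

`Literature.AlgebraicGeometry.Motives.HodgeSheaves` records as a named fact
(`hasRank_hodgeSheaf_choose X : Prop`) that for a `k`-scheme `X` (`k` any commutative ring) whose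
structure morphism `X → Spec k` is smooth of relative dimension `d` (Mathlib's
`SmoothOfRelativeDimension d`, i.e. locally standard smooth of relative dimension `d`), every Hodge
sheaf `Ωᵃ_{X/k} = ⋀ᵃ Ω¹_{X/k}` (`hodgeSheaf X a`, the sheafification of `U ↦ ⋀ᵃ_{𝒪(U)} Γ(U, Ω¹)`)
admits local generators data which are locally free data (Mathlib's
`SheafOfModules.LocalGeneratorsData.IsLocallyFreeData`) with finitely many, namely `d.choose a`,
generators on each member of the cover. This is R. Hartshorne, *Algebraic Geometry*, II Ex. 5.16(a)
("Suppose that `ℱ` is locally free of rank `n`. Then `⋀ʳ(ℱ)` is locally free of rank `C(n, r)`")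
applied to `ℱ = Ω_{X/k}`, which is locally free of rank `d` (loc. cit. II Thm. 8.15 for nonsingular
varieties over `k = k̄`, III Prop. 10.4 / 10.0.2 for smooth morphisms; in the generality of the
vendored statement The Stacks project, Tag 02G1). This file proves it
(`Literature.AlgebraicGeometry.Motives.hasRank_hodgeSheaf_choose_holds`); the statement is used
verbatim, it is not weakened, and no new named fact is introduced.

## Proof

We follow the architecture of `DifferentialsLocallyFreeProofs` (the proof of Stacks 02G1 through
`Γ(U, ·)` on affine opens and the `~` construction, rather than Hartshorne's stalkwise II.8.15),
with two new ingredients: exterior powers of *free* modules commute with localization, and the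
affine-bijectivity machinery of `DifferentialsProofs` run on a *class* of affine opens.

1. (`isLocalizedModule_exteriorPowerMap'`) If `A → B` is a localization at `S`, `M` is a free
   `A`-module with basis `b` and `g : M → N` is a localization at `S` (so `N` is free on `g ∘ b`,
   Mathlib `Basis.ofIsLocalizedModule`), then `⋀ⁿ g : ⋀ⁿ_A M → ⋀ⁿ_B N` is a localization at `S`:
   it sends the basis `b_J = ∧_{j∈J} b_j` of `⋀ⁿ_A M` (Mathlib `Basis.exteriorPower`) to the basis
   `(g∘b)_J` of `⋀ⁿ_B N`, hence `B ⊗_A ⋀ⁿ_A M ≅ ⋀ⁿ_B N` compatibly, i.e. `⋀ⁿ g` is a base change to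
   `B` (Mathlib `isLocalizedModule_iff_isBaseChange`).
2. (`bijective_app_of_mem`) The injectivity / torsion / surjectivity lemmas of `DifferentialsProofs`
   (Hartshorne II.5.1, II.5.3 for the target of a locally bijective map of presheaves of modules
   satisfying (H1)/(H2) on basic opens) hold verbatim when (H1)/(H2) are only assumed on a class `Q`
   of affine opens stable under basic opens, for the members of `Q`.
3. (`bijective_toHodgeSheaf_app`) Take `Q U :⇔ U` affine and `Γ(U, Ω¹)` free. `Q` is stable under
   basic opens, and on `U ∈ Q` the restriction `Γ(U, Ω¹) → Γ(D(f), Ω¹)` is a localization at `f`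
   ((H1)/(H2) for `Ω¹`, `DifferentialsLocallyFreeProofs`), so by (1) the presheaf
   `U ↦ ⋀ᵃ Γ(U, Ω¹)` satisfies (H1)/(H2) on `Q`, and by (2) `⋀ᵃ Γ(U, Ω¹) → Γ(U, Ωᵃ)` is bijective
   for `U ∈ Q` (Hartshorne II.5.1(d)); whence (H1)/(H2) for `Ωᵃ` itself on `Q`.
4. (`isLocalizing_hodgeSheaf_restrict`, `nonempty_free_iso_hodgeSheaf_restrict`) For `V ∈ Q` with
   basis `b : ι → Γ(V, Ω¹)`, `Ωᵃ|_{Spec Γ(X,V)}` is localizing, hence `≅ Γ(V, Ωᵃ)~` (Mathlib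
   `isIso_fromTildeΓ_iff_isLocalizing`, Hartshorne II Cor. 5.5), and
   `Γ(V, Ωᵃ) ≅ ⋀ᵃ Γ(V, Ω¹)` is free on the `a`-element subsets of `ι`, so
   `Ωᵃ|_{Spec Γ(X,V)} ≅ 𝒪^{(C(ι,a))}` (Mathlib `tildeFinsupp`).
5. (`exists_basis_sections_cotangentSheaf`) Smooth of relative dimension `d` has the ring-hom
   property `Locally (IsStandardSmoothOfRelativeDimension d)` (Mathlib), so every point has an
   affine neighbourhood `V = D(t)` with `k → Γ(X, V)` standard smooth of relative dimension `d`,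
   and then `Γ(V, Ω¹) ≅ Ω_{Γ(X,V)/k}` (Hartshorne II Rem. 8.9.2, `bijective_toCotangentSheaf_app_holds`)
   is free of rank `d` (Stacks 00T7, Mathlib `IsStandardSmoothOfRelativeDimension.rank_kaehlerDifferential`;
   `Γ(X, V) ≠ 0` as `V ∋ x`).
6. (`hasRank_hodgeSheaf_choose_holds`) Transport `𝒪^{(C(ι,a))} ≅ Ωᵃ|_{Spec Γ(X,V)}` to the
   over-site of `V` (`nonempty_free_iso_over_of_free_iso_restrict` of
   `DifferentialsLocallyFreeProofs`) and assemble `LocalGeneratorsData` indexed by the points of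
   `X`; `#(a-subsets of ι) = C(d, a)` (Mathlib `Set.powersetCard.card`).

## References

* R. Hartshorne, *Algebraic Geometry*, GTM 52, Springer (1977), doi:10.1007/978-1-4757-3849-0:
  Ch. II §5 (Prop. 5.1, Lemma 5.3, Cor. 5.5, Ex. 5.16(a) p. 127), Ch. II §8 (Rem. 8.9.2, Thm. 8.15),
  Ch. III §7 (Cor. 7.13: `Ωᵖ = ∧ᵖ Ω_{X/k}`), Ch. III §10 (Prop. 10.4). [Hartshorne1977]
* The Stacks project, Tags 00T7 (standard smooth algebras: `Ω_{S/R}` free of rank the relative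
  dimension), 01CK (6) (`∧ⁿ` of a finite locally free module is finite locally free),
  02G1 (`Ω_{X/S}` of a smooth morphism is finite locally free of rank `dim_x X_{f(x)}`).
  [StacksProject]
-/

open CategoryTheory AlgebraicGeometry Opposite TopologicalSpace
open scoped TensorProduct

universe u

namespace Literature.AlgebraicGeometry.Motives

/-! ### Sections of locally bijective maps of presheaves of modules on a class of affine opens -/

section General

-- `TopCat.Presheaf`/`TopCat.Sheaf` are not reducible: as in Mathlib's `AlgebraicGeometry.Modules`.
set_option backward.isDefEq.respectTransparency false

variable {X : Scheme.{u}} {M₀ M : X.PresheafOfModules} (φ : M₀ ⟶ M) {Q : X.Opens → Prop}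
  (hQ : ∀ ⦃U : X.Opens⦄, Q U → ∀ f : Γ(X, U), Q (X.basicOpen f))

/-- **Injectivity on affine opens of a class `Q`** (a version of `injective_app_of_isAffineOpen`
local to a class `Q` of opens stable under basic opens). Let `φ : M₀ ⟶ M` be a locally injective
morphism of presheaves of `𝒪_X`-modules such that (H1) on every affine open `U` in `Q`, a section
of `M₀(U)` vanishing on a basic open `D(f)` is killed by a power of `f`. Then `φ_U` is injective
for every affine open `U` in `Q`. (The argument of Hartshorne, *Algebraic Geometry*, II.5.1/II.5.3
for `M~`.) [folklore] -/
theorem injective_app_of_mem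
    [PresheafOfModules.IsLocallyInjective (Opens.grothendieckTopology X) φ]
    (h₁ : ∀ ⦃U : X.Opens⦄, IsAffineOpen U → Q U → ∀ (f : Γ(X, U)) (m : M₀.obj (op U)),
      M₀.map (homOfLE (X.basicOpen_le f)).op m = 0 → ∃ n : ℕ, f ^ n • m = 0)
    {U : X.Opens} (hU : IsAffineOpen U) (hQU : Q U) : Function.Injective (φ.app (op U)) := by
  intro m₁ m₂ hm
  rw [← sub_eq_zero]
  have hm0 : φ.app (op U) (m₁ - m₂) = 0 := by rw [map_sub, sub_eq_zero]; exact hm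
  have hS := Presheaf.equalizerSieve_mem (Opens.grothendieckTopology X)
    ((PresheafOfModules.toPresheaf _).map φ) (m₁ - m₂) 0
      (by change φ.app (op U) (m₁ - m₂) = φ.app (op U) 0; rw [hm0, map_zero])
  rw [← Submodule.mem_bot Γ(X, U)]
  refine Submodule.mem_of_span_eq_top_of_smul_pow_mem _ _
    (span_eq_top_of_forall_mem_basicOpen hU
      (s := {f | ∃ n : ℕ, f ^ n • (m₁ - m₂) = 0}) ?_) _ ?_
  · intro x hx
    obtain ⟨f, hxf, hf⟩ := exists_basicOpen_of_mem_grothendieckTopology hU hS hx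
    refine ⟨f, h₁ hU hQU f _ ?_, hxf⟩
    have hf' : M₀.map (homOfLE (X.basicOpen_le f)).op (m₁ - m₂) =
        M₀.map (homOfLE (X.basicOpen_le f)).op 0 := hf
    rwa [map_zero] at hf'
  · rintro ⟨f, n, hn⟩
    exact ⟨n, by simpa using hn⟩

include hQ in
/-- **Torsion lemma on affine opens of a class `Q`** (a version of
`exists_pow_smul_eq_zero_of_map_basicOpen_eq_zero` local to a class `Q` of opens stable under
basic opens; Hartshorne, *Algebraic Geometry*, II.5.3(a), for the target of a locally bijective
map). Let `φ : M₀ ⟶ M` be locally injective and locally surjective with `M` separated, and assume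
(H1) and (H2) on the affine opens in `Q`: every section of `M₀(D(f))` becomes the restriction of
a section of `M₀(U)` after multiplication by a power of `f`. If `U` is an affine open in `Q`,
`f ∈ Γ(X, U)` and `t ∈ M(U)` vanishes on `D(f)`, then `f ^ N • t = 0` for some `N`. [folklore] -/
theorem exists_pow_smul_eq_zero_of_map_basicOpen_eq_zero_of_mem
    (hM : Presheaf.IsSeparated (Opens.grothendieckTopology X) M.presheaf)
    [PresheafOfModules.IsLocallyInjective (Opens.grothendieckTopology X) φ]
    [PresheafOfModules.IsLocallySurjective (Opens.grothendieckTopology X) φ]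
    (h₁ : ∀ ⦃U : X.Opens⦄, IsAffineOpen U → Q U → ∀ (f : Γ(X, U)) (m : M₀.obj (op U)),
      M₀.map (homOfLE (X.basicOpen_le f)).op m = 0 → ∃ n : ℕ, f ^ n • m = 0)
    (h₂ : ∀ ⦃U : X.Opens⦄, IsAffineOpen U → Q U → ∀ (f : Γ(X, U))
      (y : M₀.obj (op (X.basicOpen f))), ∃ (n : ℕ) (x : M₀.obj (op U)),
        X.presheaf.map (homOfLE (X.basicOpen_le f)).op f ^ n • y =
          M₀.map (homOfLE (X.basicOpen_le f)).op x)
    {U : X.Opens} (hU : IsAffineOpen U) (hQU : Q U) (f : Γ(X, U)) (t : M.obj (op U))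
    (ht : M.map (homOfLE (X.basicOpen_le f)).op t = 0) : ∃ N : ℕ, f ^ N • t = 0 := by
  -- the `g` such that some `f ^ a • t` vanishes on `D(g)` generate the unit ideal
  have hs : Ideal.span {g : Γ(X, U) | ∃ a : ℕ,
      M.map (homOfLE (X.basicOpen_le g)).op (f ^ a • t) = 0} = ⊤ := by
    apply span_eq_top_of_forall_mem_basicOpen hU
    intro x hx
    obtain ⟨g, hxg, t₀, ht₀⟩ := exists_basicOpen_of_mem_grothendieckTopology hU
      (Presheaf.imageSieve_mem (Opens.grothendieckTopology X)
        ((PresheafOfModules.toPresheaf _).map φ) t) hx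
    refine ⟨g, ?_, hxg⟩
    have ht₀' : φ.app _ t₀ = M.map (homOfLE (X.basicOpen_le g)).op t := ht₀
    obtain ⟨n, q, hq⟩ := h₂ hU hQU g t₀
    -- on `D(g)`, `φ_U q` and `g ^ n • t` agree
    have key : M.map (homOfLE (X.basicOpen_le g)).op (φ.app _ q) =
        M.map (homOfLE (X.basicOpen_le g)).op (g ^ n • t) := by
      rw [← PresheafOfModules.naturality_apply, ← hq, (φ.app _).hom.map_smul, ht₀',
        PresheafOfModules.map_smul, map_pow]
      rfl
    -- restrict to `W = D(fg) = D(f) ∩ D(g)`, where `t` vanishes: there `φ q = 0`, so `q = 0`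
    have hWf : X.basicOpen (f * g) ≤ X.basicOpen f := by
      rw [Scheme.basicOpen_mul]; exact inf_le_left
    have hWg : X.basicOpen (f * g) ≤ X.basicOpen g := by
      rw [Scheme.basicOpen_mul]; exact inf_le_right
    have hqW : M₀.map (homOfLE (X.basicOpen_le (f * g))).op q = 0 := by
      apply injective_app_of_mem φ h₁ (hU.basicOpen (f * g)) (hQ hQU (f * g))
      rw [map_zero, PresheafOfModules.naturality_apply,
        opens_op_hom_ext (homOfLE (X.basicOpen_le (f * g))).op
          ((homOfLE (X.basicOpen_le g)).op ≫ (homOfLE hWg).op),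
        PresheafOfModules.map_comp_apply, key, ← PresheafOfModules.map_comp_apply,
        opens_op_hom_ext ((homOfLE (X.basicOpen_le g)).op ≫ (homOfLE hWg).op)
          ((homOfLE (X.basicOpen_le f)).op ≫ (homOfLE hWf).op),
        PresheafOfModules.map_comp_apply, PresheafOfModules.map_smul, ht, smul_zero, map_zero]
    obtain ⟨a, ha⟩ := h₁ hU hQU (f * g) q hqW
    refine ⟨a, ?_⟩
    -- apply `φ` and restrict to `D(g)`, where `g` is a unit
    have h3 : M.map (homOfLE (X.basicOpen_le g)).op ((f * g) ^ a • φ.app _ q) = 0 := by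
      rw [← (φ.app _).hom.map_smul]
      change M.map _ (φ.app _ ((f * g) ^ a • q)) = 0
      rw [ha, map_zero, map_zero]
    have h4 : (f * g) ^ a * g ^ n = g ^ (a + n) * f ^ a := by ring
    rw [PresheafOfModules.map_smul, key, ← PresheafOfModules.map_smul, smul_smul, h4,
      ← smul_smul, PresheafOfModules.map_smul, map_pow] at h3
    exact ((X.toRingedSpace.isUnit_res_basicOpen g).pow (a + n)).smul_eq_zero.mp h3
  -- finitely many such `g` suffice; take the largest exponent and use that `M` is separated
  obtain ⟨T, hTs, hT⟩ := (Ideal.span_eq_top_iff_finite _).mp hs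
  choose a ha using fun g : T => hTs g.2
  -- the covering sieve of opens contained in some `D(g)`, `g ∈ T`
  let S : Sieve U :=
    { arrows := fun W _ => ∃ g ∈ T, W ≤ X.basicOpen g
      downward_closed := by
        rintro W W' i ⟨g, hg, hW⟩ j
        exact ⟨g, hg, j.le.trans hW⟩ }
  have hS : S ∈ Opens.grothendieckTopology X U := fun x hx => by
    obtain ⟨⟨g, hg⟩, hxg⟩ := Opens.mem_iSup.mp (hU.self_le_iSup_basicOpen_iff.mpr hT hx)
    exact ⟨X.basicOpen g, homOfLE (X.basicOpen_le g), ⟨g, hg, le_rfl⟩, hxg⟩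
  refine ⟨Finset.univ.sup a, hM U S hS _ _ ?_⟩
  rintro W i ⟨g, hg, hWg⟩
  change M.map i.op _ = M.map i.op 0
  rw [map_zero, opens_op_hom_ext i.op ((homOfLE (X.basicOpen_le g)).op ≫ (homOfLE hWg).op),
    PresheafOfModules.map_comp_apply,
    ← Nat.sub_add_cancel (Finset.le_sup (f := a) (Finset.mem_univ ⟨g, hg⟩)), pow_add,
    mul_smul, PresheafOfModules.map_smul, ha ⟨g, hg⟩, smul_zero, map_zero]

include hQ in
/-- **Surjectivity on affine opens of a class `Q`** (a version of `surjective_app_of_isAffineOpen`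
local to a class `Q` of opens stable under basic opens). Under the hypotheses of the torsion
lemma (`φ : M₀ ⟶ M` locally injective and locally surjective, `M` separated, (H1), (H2) on the
affine opens in `Q`), `φ_U : M₀(U) → M(U)` is surjective for every affine open `U` in `Q`.
(The argument of Hartshorne, *Algebraic Geometry*, II.5.1(d): `Γ(Spec A, M~) = M`.) [folklore] -/
theorem surjective_app_of_mem
    (hM : Presheaf.IsSeparated (Opens.grothendieckTopology X) M.presheaf)
    [PresheafOfModules.IsLocallyInjective (Opens.grothendieckTopology X) φ]
    [PresheafOfModules.IsLocallySurjective (Opens.grothendieckTopology X) φ]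
    (h₁ : ∀ ⦃U : X.Opens⦄, IsAffineOpen U → Q U → ∀ (f : Γ(X, U)) (m : M₀.obj (op U)),
      M₀.map (homOfLE (X.basicOpen_le f)).op m = 0 → ∃ n : ℕ, f ^ n • m = 0)
    (h₂ : ∀ ⦃U : X.Opens⦄, IsAffineOpen U → Q U → ∀ (f : Γ(X, U))
      (y : M₀.obj (op (X.basicOpen f))), ∃ (n : ℕ) (x : M₀.obj (op U)),
        X.presheaf.map (homOfLE (X.basicOpen_le f)).op f ^ n • y =
          M₀.map (homOfLE (X.basicOpen_le f)).op x)
    {U : X.Opens} (hU : IsAffineOpen U) (hQU : Q U) : Function.Surjective (φ.app (op U)) := by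
  intro s
  suffices hs : s ∈ LinearMap.range (φ.app (op U)).hom by
    obtain ⟨x, hx⟩ := LinearMap.mem_range.mp hs
    exact ⟨x, hx⟩
  refine Submodule.mem_of_span_eq_top_of_smul_pow_mem _ _
    (span_eq_top_of_forall_mem_basicOpen hU
      (s := {f | ∃ n : ℕ, f ^ n • s ∈ LinearMap.range (φ.app (op U)).hom}) ?_) s ?_
  · intro x hx
    obtain ⟨f, hxf, t₀, ht₀⟩ := exists_basicOpen_of_mem_grothendieckTopology hU
      (Presheaf.imageSieve_mem (Opens.grothendieckTopology X)
        ((PresheafOfModules.toPresheaf _).map φ) s) hx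
    refine ⟨f, ?_, hxf⟩
    have ht₀' : φ.app _ t₀ = M.map (homOfLE (X.basicOpen_le f)).op s := ht₀
    obtain ⟨n, q, hq⟩ := h₂ hU hQU f t₀
    have key : M.map (homOfLE (X.basicOpen_le f)).op (φ.app _ q - f ^ n • s) = 0 := by
      rw [map_sub, ← PresheafOfModules.naturality_apply, ← hq, (φ.app _).hom.map_smul, ht₀',
        PresheafOfModules.map_smul, map_pow, sub_eq_zero]
      rfl
    obtain ⟨N, hN⟩ :=
      exists_pow_smul_eq_zero_of_map_basicOpen_eq_zero_of_mem φ hQ hM h₁ h₂ hU hQU f _ key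
    refine ⟨N + n, f ^ N • q, ?_⟩
    rw [smul_sub, sub_eq_zero, smul_smul, ← pow_add] at hN
    rw [map_smul, hN]
  · rintro ⟨f, n, hn⟩
    exact ⟨n, hn⟩

include hQ in
/-- **Bijectivity on affine opens of a class `Q`** (stable under basic opens) of a locally
bijective morphism `φ : M₀ ⟶ M` of presheaves of `𝒪_X`-modules with separated target whose
source is "quasi-coherent on basic opens of members of `Q`" ((H1) and (H2) there); in particular
of the sheafification map of such an `M₀` (a version of `bijective_app_of_isAffineOpen` local to
`Q`; Hartshorne, *Algebraic Geometry*, II.5.1: `Γ(D(f), M~) = M_f`, `Γ(Spec A, M~) = M`).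
[folklore] -/
theorem bijective_app_of_mem
    (hM : Presheaf.IsSeparated (Opens.grothendieckTopology X) M.presheaf)
    [PresheafOfModules.IsLocallyInjective (Opens.grothendieckTopology X) φ]
    [PresheafOfModules.IsLocallySurjective (Opens.grothendieckTopology X) φ]
    (h₁ : ∀ ⦃U : X.Opens⦄, IsAffineOpen U → Q U → ∀ (f : Γ(X, U)) (m : M₀.obj (op U)),
      M₀.map (homOfLE (X.basicOpen_le f)).op m = 0 → ∃ n : ℕ, f ^ n • m = 0)
    (h₂ : ∀ ⦃U : X.Opens⦄, IsAffineOpen U → Q U → ∀ (f : Γ(X, U))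
      (y : M₀.obj (op (X.basicOpen f))), ∃ (n : ℕ) (x : M₀.obj (op U)),
        X.presheaf.map (homOfLE (X.basicOpen_le f)).op f ^ n • y =
          M₀.map (homOfLE (X.basicOpen_le f)).op x)
    {U : X.Opens} (hU : IsAffineOpen U) (hQU : Q U) : Function.Bijective (φ.app (op U)) :=
  ⟨injective_app_of_mem φ h₁ hU hQU, surjective_app_of_mem φ hQ hM h₁ h₂ hU hQU⟩

end General

/-! ### Exterior powers commute with localization (free modules) -/

section ExteriorLocalization

variable {A B : Type u} [CommRing A] [CommRing B] [Algebra A B] (S : Submonoid A)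
  [IsLocalization S B] {M : ModuleCat.{u} A} {N : ModuleCat.{u} B}

/-- For an `A`-algebra `B` and a `B`-module `N`, the `A`-module `N|_A` (restriction of scalars
along `algebraMap A B`, Mathlib's `ModuleCat.restrictScalars`) is a scalar tower `A → B → N`.
[folklore] -/
theorem isScalarTower_restrictScalars_algebraMap (N : ModuleCat.{u} B) :
    IsScalarTower A B ((ModuleCat.restrictScalars (algebraMap A B)).obj N) :=
  IsScalarTower.of_algebraMap_smul fun _ _ => rfl

set_option backward.isDefEq.respectTransparency false in
/-- Let `A → B` be a localization at `S`, `b` an `A`-basis of `M` indexed by a linearly ordered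
type `ι`, and `g : M → N|_A` a localization at `S` of a `B`-module `N`, so that `g ∘ b` is a
`B`-basis of `N` (Mathlib's `Basis.ofIsLocalizedModule`). Then the induced map on exterior powers
`⋀ⁿ g : ⋀ⁿ_A M → ⋀ⁿ_B N` (`exteriorPowerMap'`) sends the basis vector `b_J = ∧_{j ∈ J} b_j`
(`J ⊆ ι` with `#J = n`, Mathlib's `Basis.exteriorPower`) to the basis vector `(g ∘ b)_J`.
[folklore] -/
theorem exteriorPowerMap'_basis {ι : Type*} [LinearOrder ι] (b : Module.Basis ι A M)
    (g : M ⟶ (ModuleCat.restrictScalars (algebraMap A B)).obj N) [IsLocalizedModule S g.hom]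
    [IsScalarTower A B ((ModuleCat.restrictScalars (algebraMap A B)).obj N)]
    (n : ℕ) (s : Set.powersetCard ι n) :
    exteriorPowerMap' g n (b.exteriorPower n s) =
      (b.ofIsLocalizedModule B S g.hom).exteriorPower n s := by
  rw [exteriorPower.basis_apply, exteriorPower.basis_apply, exteriorPower.ιMulti_family,
    exteriorPower.ιMulti_family]
  have h := exteriorPowerMap'_mk g (n := n) (b ∘ (Set.powersetCard.ofFinEmbEquiv.symm s))
  change exteriorPowerMap' g n (ModuleCat.exteriorPower.mk _) = ModuleCat.exteriorPower.mk (M := N) _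
  rw [h]
  congr 1
  funext i
  simp [Module.Basis.ofIsLocalizedModule_apply]

set_option backward.isDefEq.respectTransparency false in
/-- **Exterior powers of free modules commute with localization.** Let `A → B` be a
localization at `S`, `M` a free `A`-module and `g : M → N|_A` a localization at `S` of a
`B`-module `N` (i.e. `N = S⁻¹M`). Then `⋀ⁿ g : ⋀ⁿ_A M → (⋀ⁿ_B N)|_A` is a localization at `S`,
i.e. `S⁻¹(⋀ⁿ_A M) = ⋀ⁿ_{S⁻¹A}(S⁻¹M)`: `⋀ⁿ g` maps a basis of `⋀ⁿ_A M` to a basis of `⋀ⁿ_B N`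
(`exteriorPowerMap'_basis`), so `B ⊗_A ⋀ⁿ_A M ≅ ⋀ⁿ_B N` compatibly with `⋀ⁿ g`
(Mathlib's `Basis.baseChange`, `IsBaseChange.of_equiv`), and a base change to the localization `B`
is a localization (Mathlib's `isLocalizedModule_iff_isBaseChange`). (The special case, for free
modules, of the compatibility of `⋀ⁿ` with localization used in Hartshorne, *Algebraic Geometry*,
II Ex. 5.16.) [folklore] -/
theorem isLocalizedModule_exteriorPowerMap' {ι : Type u} (b : Module.Basis ι A M)
    (g : M ⟶ (ModuleCat.restrictScalars (algebraMap A B)).obj N) [IsLocalizedModule S g.hom]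
    (n : ℕ) : IsLocalizedModule S (exteriorPowerMap' g n).hom := by
  classical
  letI : LinearOrder ι := linearOrderOfSTO WellOrderingRel
  haveI := isScalarTower_restrictScalars_algebraMap (A := A) N
  haveI := isScalarTower_restrictScalars_algebraMap (A := A) (N.exteriorPower n)
  let bn : Module.Basis (Set.powersetCard ι n) A (M.exteriorPower n) := b.exteriorPower n
  let cn : Module.Basis (Set.powersetCard ι n) B
      ((ModuleCat.restrictScalars (algebraMap A B)).obj (N.exteriorPower n)) :=
    (b.ofIsLocalizedModule B S g.hom).exteriorPower n
  let e : B ⊗[A] (M.exteriorPower n) ≃ₗ[B]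
      ((ModuleCat.restrictScalars (algebraMap A B)).obj (N.exteriorPower n)) :=
    (bn.baseChange B).equiv cn (Equiv.refl _)
  rw [isLocalizedModule_iff_isBaseChange S B]
  refine IsBaseChange.of_equiv e fun x => ?_
  have key : (e.restrictScalars A).toLinearMap ∘ₗ (TensorProduct.mk A B (M.exteriorPower n) 1) =
      (exteriorPowerMap' g n).hom := by
    refine bn.ext fun s => ?_
    simp only [LinearMap.coe_comp, Function.comp_apply, TensorProduct.mk_apply,
      LinearEquiv.coe_coe, LinearEquiv.restrictScalars_apply]
    rw [← Module.Basis.baseChange_apply, Module.Basis.equiv_apply, Equiv.refl_apply]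
    exact (exteriorPowerMap'_basis S b g n s).symm
  exact LinearMap.congr_fun key x

end ExteriorLocalization

/-! ### `Γ(U, Ω¹) → Γ(D(f), Ω¹)` is a localization; (H1)/(H2) for `U ↦ ⋀ᵃ Γ(U, Ω¹)` -/

section CotangentLocalization

-- `TopCat.Presheaf`/`TopCat.Sheaf` are not reducible: as in Mathlib's `AlgebraicGeometry.Modules`.
set_option backward.isDefEq.respectTransparency false

variable {k : Type u} [CommRing k] (X : Over (Spec (CommRingCat.of k)))

/-- On an affine open `U` of a `k`-scheme `X`, the restriction map `Γ(U, Ω¹_{X/k}) → Γ(D(f), Ω¹_{X/k})`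
is a localization at `f` (as a `Γ(X, U)`-linear map into the restriction of scalars along
`Γ(X, U) → Γ(X, D(f)) = Γ(X, U)_f`): `f` acts invertibly on `Γ(D(f), Ω¹)`, and (H1)/(H2) hold for
`Ω¹` on affine opens (`cotangentSheaf_exists_pow_smul_eq_zero`/`_eq_map` of
`DifferentialsLocallyFreeProofs`; Hartshorne, *Algebraic Geometry*, II Prop. 5.1(c) with
Rem. 8.9.2 and Prop. 8.2A: `Γ(D(f), Ω¹) = Ω_{B_f/k} = (Ω_{B/k})_f`).
[cite: Hartshorne1977, II Prop. 8.2A and Rem. 8.9.2] -/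
theorem isLocalizedModule_cotangentSheaf_map {U : X.left.Opens} (hU : IsAffineOpen U)
    (f : Γ(X.left, U)) :
    IsLocalizedModule (.powers f) (ModuleCat.Hom.hom
      (show (cotangentSheaf X).val.obj (op U) ⟶ (ModuleCat.restrictScalars
          (algebraMap Γ(X.left, U) Γ(X.left, X.left.basicOpen f))).obj
          ((cotangentSheaf X).val.obj (op (X.left.basicOpen f))) from
        (cotangentSheaf X).val.map (homOfLE (X.left.basicOpen_le f)).op)) := by
  refine IsLocalizedModule.Away.mk_of_addCommGroup ?_ ?_ ?_
  · rw [Module.End.isUnit_iff]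
    exact (X.left.toRingedSpace.isUnit_res_basicOpen f).smul_bijective
      (β := (cotangentSheaf X).val.obj (op (X.left.basicOpen f)))
  · intro x
    obtain ⟨n, y, h⟩ := cotangentSheaf_exists_pow_smul_eq_map X hU f rfl
      (homOfLE (X.left.basicOpen_le f)) x
    refine ⟨n, y, ?_⟩
    rw [← map_pow] at h
    exact h
  · intro y hy
    exact cotangentSheaf_exists_pow_smul_eq_zero X hU f rfl (homOfLE (X.left.basicOpen_le f)) y hy

/-- If `Γ(U, Ω¹_{X/k})` is free over `Γ(X, U)` (`U` affine), then so is `Γ(D(f), Ω¹_{X/k})` over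
`Γ(X, D(f)) = Γ(X, U)_f`, on the localized basis (Mathlib's `Basis.ofIsLocalizedModule`): the class
of affine opens on which `Ω¹` is free is stable under basic opens. [folklore] -/
theorem free_sections_cotangentSheaf_basicOpen {U : X.left.Opens} (hU : IsAffineOpen U)
    [Module.Free Γ(X.left, U) Γ(cotangentSheaf X, U)] (f : Γ(X.left, U)) :
    Module.Free Γ(X.left, X.left.basicOpen f) Γ(cotangentSheaf X, X.left.basicOpen f) := by
  haveI := hU.isLocalization_basicOpen f
  haveI := isLocalizedModule_cotangentSheaf_map X hU f
  haveI := isScalarTower_restrictScalars_algebraMap (A := Γ(X.left, U))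
    (B := Γ(X.left, X.left.basicOpen f)) ((cotangentSheaf X).val.obj (op (X.left.basicOpen f)))
  exact Module.Free.of_basis ((Module.Free.chooseBasis Γ(X.left, U)
    Γ(cotangentSheaf X, U)).ofIsLocalizedModule Γ(X.left, X.left.basicOpen f) (.powers f)
      (ModuleCat.Hom.hom (show (cotangentSheaf X).val.obj (op U) ⟶ (ModuleCat.restrictScalars
          (algebraMap Γ(X.left, U) Γ(X.left, X.left.basicOpen f))).obj
          ((cotangentSheaf X).val.obj (op (X.left.basicOpen f))) from
        (cotangentSheaf X).val.map (homOfLE (X.left.basicOpen_le f)).op)))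

/-- (H1) for the presheaf `U ↦ ⋀ᵃ_{𝒪(U)} Γ(U, Ω¹)` on an affine open `U` with `Γ(U, Ω¹)` free: an
element of `⋀ᵃ Γ(U, Ω¹)` vanishing in `⋀ᵃ Γ(D(f), Ω¹)` is killed by a power of `f`, because
`⋀ᵃ Γ(D(f), Ω¹) = (⋀ᵃ Γ(U, Ω¹))_f` (`isLocalizedModule_exteriorPowerMap'`). [folklore] -/
theorem exteriorPowerPresheaf_exists_pow_smul_eq_zero (a : ℕ) ⦃U : X.left.Opens⦄
    (hU : IsAffineOpen U) (hF : Module.Free Γ(X.left, U) Γ(cotangentSheaf X, U))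
    (f : Γ(X.left, U)) (m : (exteriorPowerPresheaf (cotangentSheaf X).val a).obj (op U))
    (hm : (exteriorPowerPresheaf (cotangentSheaf X).val a).map
      (homOfLE (X.left.basicOpen_le f)).op m = 0) :
    ∃ n : ℕ, f ^ n • m = 0 := by
  haveI := hU.isLocalization_basicOpen f
  haveI := isLocalizedModule_cotangentSheaf_map X hU f
  let g : (cotangentSheaf X).val.obj (op U) ⟶ (ModuleCat.restrictScalars
      (algebraMap Γ(X.left, U) Γ(X.left, X.left.basicOpen f))).obj
        ((cotangentSheaf X).val.obj (op (X.left.basicOpen f))) :=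
    (cotangentSheaf X).val.map (homOfLE (X.left.basicOpen_le f)).op
  haveI hl := isLocalizedModule_exteriorPowerMap' (.powers f)
    (Module.Free.chooseBasis Γ(X.left, U) Γ(cotangentSheaf X, U)) g a
  have hm' : (exteriorPowerMap' (A := Γ(X.left, U)) (B := Γ(X.left, X.left.basicOpen f)) g a).hom
      m = (exteriorPowerMap' (A := Γ(X.left, U)) (B := Γ(X.left, X.left.basicOpen f)) g a).hom
      0 := by
    rw [map_zero]; exact hm
  obtain ⟨⟨_, n, rfl⟩, hn⟩ := IsLocalizedModule.exists_of_eq (S := Submonoid.powers f) hm'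
  exact ⟨n, by simpa [Submonoid.smul_def] using hn⟩

/-- (H2) for the presheaf `U ↦ ⋀ᵃ_{𝒪(U)} Γ(U, Ω¹)` on an affine open `U` with `Γ(U, Ω¹)` free:
every element of `⋀ᵃ Γ(D(f), Ω¹)` becomes the restriction of an element of `⋀ᵃ Γ(U, Ω¹)` after
multiplication by a power of `f`, because `⋀ᵃ Γ(D(f), Ω¹) = (⋀ᵃ Γ(U, Ω¹))_f`
(`isLocalizedModule_exteriorPowerMap'`). [folklore] -/
theorem exteriorPowerPresheaf_exists_pow_smul_eq_map (a : ℕ) ⦃U : X.left.Opens⦄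
    (hU : IsAffineOpen U) (hF : Module.Free Γ(X.left, U) Γ(cotangentSheaf X, U))
    (f : Γ(X.left, U))
    (y : (exteriorPowerPresheaf (cotangentSheaf X).val a).obj (op (X.left.basicOpen f))) :
    ∃ (n : ℕ) (x : (exteriorPowerPresheaf (cotangentSheaf X).val a).obj (op U)),
      X.left.presheaf.map (homOfLE (X.left.basicOpen_le f)).op f ^ n • y =
        (exteriorPowerPresheaf (cotangentSheaf X).val a).map
          (homOfLE (X.left.basicOpen_le f)).op x := by
  haveI := hU.isLocalization_basicOpen f
  haveI := isLocalizedModule_cotangentSheaf_map X hU f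
  let g : (cotangentSheaf X).val.obj (op U) ⟶ (ModuleCat.restrictScalars
      (algebraMap Γ(X.left, U) Γ(X.left, X.left.basicOpen f))).obj
        ((cotangentSheaf X).val.obj (op (X.left.basicOpen f))) :=
    (cotangentSheaf X).val.map (homOfLE (X.left.basicOpen_le f)).op
  haveI hl := isLocalizedModule_exteriorPowerMap' (.powers f)
    (Module.Free.chooseBasis Γ(X.left, U) Γ(cotangentSheaf X, U)) g a
  obtain ⟨⟨x, s⟩, hx⟩ := IsLocalizedModule.surj (Submonoid.powers f)
    (exteriorPowerMap' (A := Γ(X.left, U)) (B := Γ(X.left, X.left.basicOpen f)) g a).hom y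
  obtain ⟨n, hn⟩ := (Submonoid.mem_powers_iff _ _).mp s.2
  refine ⟨n, x, ?_⟩
  dsimp only at hx
  change _ = (exteriorPowerMap' (A := Γ(X.left, U)) (B := Γ(X.left, X.left.basicOpen f)) g a).hom x
  rw [← hx, Submonoid.smul_def, ← hn, ← map_pow]
  rfl

end CotangentLocalization

/-! ### Sections of the Hodge sheaf on affine opens where `Ω¹` is free -/

section HodgeAffine

-- `TopCat.Presheaf`/`TopCat.Sheaf` are not reducible: as in Mathlib's `AlgebraicGeometry.Modules`.
set_option backward.isDefEq.respectTransparency false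

variable {k : Type u} [CommRing k] (X : Over (Spec (CommRingCat.of k))) (a : ℕ)

/-- **`Γ(U, Ωᵃ) = ⋀ᵃ Γ(U, Ω¹)` on affine opens `U` with `Γ(U, Ω¹)` free**: the component at `U` of
the sheafification map `⋀ᵃ_{𝒪(U)} Γ(U, Ω¹) → Γ(U, Ωᵃ)` (the unit of Mathlib's sheafification
adjunction for presheaves of modules at `U ↦ ⋀ᵃ Γ(U, Ω¹)`, which is locally injective and locally
surjective) is bijective (Hartshorne, *Algebraic Geometry*, II.5.1(d) `Γ(Spec A, M~) = M` for
`M = ⋀ᵃ Γ(U, Ω¹)`, via `bijective_app_of_mem` on the class of affine opens where `Ω¹` is free,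
which is stable under basic opens). [folklore] -/
theorem bijective_toHodgeSheaf_app {U : X.left.Opens} (hU : IsAffineOpen U)
    (hF : Module.Free Γ(X.left, U) Γ(cotangentSheaf X, U)) :
    Function.Bijective ((show exteriorPowerPresheaf (cotangentSheaf X).val a ⟶
        (PresheafOfModules.restrictScalars (𝟙 X.left.ringCatSheaf.obj)).obj (hodgeSheaf X a).val from
      (PresheafOfModules.sheafificationAdjunction (𝟙 X.left.ringCatSheaf.obj)).unit.app
        (exteriorPowerPresheaf (cotangentSheaf X).val a)).app (op U)) :=
  @bijective_app_of_mem X.left _ _ _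
    (fun U => IsAffineOpen U ∧ Module.Free Γ(X.left, U) Γ(cotangentSheaf X, U))
    (fun U hQ f => ⟨hQ.1.basicOpen f, @free_sections_cotangentSheaf_basicOpen _ _ X U hQ.1 hQ.2 f⟩)
    (hodgeSheaf X a).isSheaf.isSeparated
    (inferInstanceAs (Presheaf.IsLocallyInjective _
      (toSheafify _ (exteriorPowerPresheaf (cotangentSheaf X).val a).presheaf)))
    (inferInstanceAs (Presheaf.IsLocallySurjective _
      (toSheafify _ (exteriorPowerPresheaf (cotangentSheaf X).val a).presheaf)))
    (fun _ hU hQ => exteriorPowerPresheaf_exists_pow_smul_eq_zero X a hU hQ.2)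
    (fun _ hU hQ => exteriorPowerPresheaf_exists_pow_smul_eq_map X a hU hQ.2) U hU ⟨hU, hF⟩

/-- (H1) for the Hodge sheaf `Ωᵃ` on an affine open `U` with `Γ(U, Ω¹)` free: a section of `Ωᵃ`
over `U` vanishing on the basic open `D(g)` (given as any open `W = D(g)`) is killed by a power of
`g` (Hartshorne, *Algebraic Geometry*, II Lemma 5.3(a) for `(⋀ᵃ Γ(U, Ω¹))~`). [folklore] -/
theorem hodgeSheaf_exists_pow_smul_eq_zero {U W : X.left.Opens} (hU : IsAffineOpen U)
    (hF : Module.Free Γ(X.left, U) Γ(cotangentSheaf X, U))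
    (g : Γ(X.left, U)) (hW : W = X.left.basicOpen g) (i : W ⟶ U)
    (y : (hodgeSheaf X a).val.obj (op U))
    (hy : (hodgeSheaf X a).val.map i.op y = 0) : ∃ n : ℕ, g ^ n • y = 0 := by
  -- the sheafification map `φ`, bijective on affine opens where `Ω¹` is free
  obtain ⟨φ, hφ⟩ : ∃ φ : exteriorPowerPresheaf (cotangentSheaf X).val a ⟶
      (PresheafOfModules.restrictScalars (𝟙 X.left.ringCatSheaf.obj)).obj (hodgeSheaf X a).val,
      ∀ ⦃U : X.left.Opens⦄, IsAffineOpen U → Module.Free Γ(X.left, U) Γ(cotangentSheaf X, U) →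
        Function.Bijective (φ.app (op U)) :=
    ⟨_, fun U hU hF => bijective_toHodgeSheaf_app X a hU hF⟩
  subst hW
  obtain ⟨p, rfl⟩ := (hφ hU hF).2 y
  have hi : i = homOfLE (X.left.basicOpen_le g) := Subsingleton.elim _ _
  subst hi
  have h1 : φ.app _ ((exteriorPowerPresheaf (cotangentSheaf X).val a).map
      (homOfLE (X.left.basicOpen_le g)).op p) = 0 := by
    rw [PresheafOfModules.naturality_apply]
    exact hy
  have h2 : (exteriorPowerPresheaf (cotangentSheaf X).val a).map
      (homOfLE (X.left.basicOpen_le g)).op p = 0 :=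
    (hφ (hU.basicOpen g) (@free_sections_cotangentSheaf_basicOpen _ _ X U hU hF g)).1
      (h1.trans (map_zero _).symm)
  obtain ⟨n, hn⟩ := exteriorPowerPresheaf_exists_pow_smul_eq_zero X a hU hF g p h2
  refine ⟨n, ?_⟩
  change g ^ n • φ.app (op U) p = 0
  rw [← (φ.app (op U)).hom.map_smul, hn, map_zero]

/-- (H2) for the Hodge sheaf `Ωᵃ` on an affine open `U` with `Γ(U, Ω¹)` free: every section of
`Ωᵃ` over the basic open `D(g)` (given as any open `W = D(g)`) becomes the restriction of a
section over `U` after multiplication by a power of `g` (Hartshorne, *Algebraic Geometry*,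
II Lemma 5.3(b) for `(⋀ᵃ Γ(U, Ω¹))~`). [folklore] -/
theorem hodgeSheaf_exists_pow_smul_eq_map {U W : X.left.Opens} (hU : IsAffineOpen U)
    (hF : Module.Free Γ(X.left, U) Γ(cotangentSheaf X, U))
    (g : Γ(X.left, U)) (hW : W = X.left.basicOpen g) (i : W ⟶ U)
    (x : (hodgeSheaf X a).val.obj (op W)) :
    ∃ (n : ℕ) (y : (hodgeSheaf X a).val.obj (op U)),
      X.left.presheaf.map i.op g ^ n • x = (hodgeSheaf X a).val.map i.op y := by
  -- the sheafification map `φ`, bijective on affine opens where `Ω¹` is free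
  obtain ⟨φ, hφ⟩ : ∃ φ : exteriorPowerPresheaf (cotangentSheaf X).val a ⟶
      (PresheafOfModules.restrictScalars (𝟙 X.left.ringCatSheaf.obj)).obj (hodgeSheaf X a).val,
      ∀ ⦃U : X.left.Opens⦄, IsAffineOpen U → Module.Free Γ(X.left, U) Γ(cotangentSheaf X, U) →
        Function.Bijective (φ.app (op U)) :=
    ⟨_, fun U hU hF => bijective_toHodgeSheaf_app X a hU hF⟩
  subst hW
  have hi : i = homOfLE (X.left.basicOpen_le g) := Subsingleton.elim _ _
  subst hi
  obtain ⟨q, rfl⟩ :=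
    (hφ (hU.basicOpen g) (@free_sections_cotangentSheaf_basicOpen _ _ X U hU hF g)).2 x
  obtain ⟨n, p, hp⟩ := exteriorPowerPresheaf_exists_pow_smul_eq_map X a hU hF g q
  refine ⟨n, φ.app (op U) p, ?_⟩
  change _ • φ.app _ q = _
  rw [← (φ.app _).hom.map_smul, hp, PresheafOfModules.naturality_apply]
  rfl

end HodgeAffine

/-! ### `Ωᵃ` restricted to `Spec Γ(X, V)` is `Γ(V, Ωᵃ)~ ≅ 𝒪^{C(ι,a)}` when `Γ(V, Ω¹) ≅ 𝒪(V)^ι` -/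

section HodgeRestrictSpec

-- `TopCat.Presheaf`/`TopCat.Sheaf` are not reducible: as in Mathlib's `AlgebraicGeometry.Modules`.
set_option backward.isDefEq.respectTransparency false

variable {k : Type u} [CommRing k] (X : Over (Spec (CommRingCat.of k))) (a : ℕ)
  {V : X.left.Opens}

/-- The restriction of `Ωᵃ_{X/k}` to `Spec Γ(X, V) → X`, for an affine open `V` with `Γ(V, Ω¹)`
free, is *localizing*: its sections over `D(f)` are the localization at `f` of its global sections
(Hartshorne, *Algebraic Geometry*, II Prop. 5.1(c),(d) for `(⋀ᵃ Γ(V, Ω¹))~`).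
[cite: Hartshorne1977, II Prop. 5.1(c)] -/
theorem isLocalizing_hodgeSheaf_restrict (hV : IsAffineOpen V)
    (hF : Module.Free Γ(X.left, V) Γ(cotangentSheaf X, V)) :
    IsLocalizing (modulesSpecToSheaf.obj ((hodgeSheaf X a).restrict hV.fromSpec)) := by
  intro f
  have hle₁ : hV.fromSpec ''ᵁ ⊤ ≤ V := fromSpec_image_le hV ⊤
  have hW₁ : IsAffineOpen (hV.fromSpec ''ᵁ ⊤) := by rw [fromSpec_image_top hV]; exact hV
  have hF₁ : Module.Free Γ(X.left, hV.fromSpec ''ᵁ ⊤) Γ(cotangentSheaf X, hV.fromSpec ''ᵁ ⊤) := by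
    rw [fromSpec_image_top hV]; exact hF
  have hW : hV.fromSpec ''ᵁ PrimeSpectrum.basicOpen f =
      X.left.basicOpen (X.left.presheaf.map (homOfLE hle₁).op f) := by
    rw [hV.fromSpec_image_basicOpen, Scheme.basicOpen_res, fromSpec_image_top hV, eq_comm,
      inf_eq_right]
    exact X.left.basicOpen_le f
  let i : hV.fromSpec ''ᵁ PrimeSpectrum.basicOpen f ⟶ hV.fromSpec ''ᵁ ⊤ :=
    homOfLE (hV.fromSpec.image_mono le_top)
  have hf : X.left.presheaf.map i.op (X.left.presheaf.map (homOfLE hle₁).op f) =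
      X.left.presheaf.map (homOfLE (fromSpec_image_le hV (PrimeSpectrum.basicOpen f))).op f := by
    rw [← CommRingCat.comp_apply, ← Functor.map_comp, opens_op_hom_ext (_ ≫ _) (homOfLE _).op]
  refine IsLocalizedModule.Away.mk_of_addCommGroup ?_ ?_ ?_
  · exact Scheme.Modules.isUnit_algebraMap_end_of_le_basicOpen f le_rfl
  · intro x
    obtain ⟨n, y, h⟩ := hodgeSheaf_exists_pow_smul_eq_map X a hW₁ hF₁ _ hW i x
    refine ⟨n, y, ?_⟩
    change f ^ n • (show Γ((hodgeSheaf X a).restrict hV.fromSpec, PrimeSpectrum.basicOpen f)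
      from x) = _
    rw [restrict_fromSpec_smul_def, map_pow, ← hf]
    exact h
  · intro y hy
    obtain ⟨n, hn⟩ := hodgeSheaf_exists_pow_smul_eq_zero X a hW₁ hF₁ _ hW i y hy
    refine ⟨n, ?_⟩
    change f ^ n • (show Γ((hodgeSheaf X a).restrict hV.fromSpec, ⊤) from y) = 0
    rw [restrict_fromSpec_smul_def, map_pow]
    exact hn

/-- Hence the restriction of `Ωᵃ_{X/k}` to `Spec Γ(X, V)` (`V` affine with `Γ(V, Ω¹)` free) is
`Γ(V, Ωᵃ)~`: the canonical map `fromTildeΓ` is an isomorphism (Mathlib's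
`isIso_fromTildeΓ_iff_isLocalizing`; Hartshorne, *Algebraic Geometry*, II Cor. 5.5).
[cite: Hartshorne1977, II Cor. 5.5] -/
theorem isIso_fromTildeΓ_hodgeSheaf_restrict (hV : IsAffineOpen V)
    (hF : Module.Free Γ(X.left, V) Γ(cotangentSheaf X, V)) :
    IsIso ((hodgeSheaf X a).restrict hV.fromSpec).fromTildeΓ :=
  (isIso_fromTildeΓ_iff_isLocalizing _).mpr (isLocalizing_hodgeSheaf_restrict X a hV hF)

/-- A basis `b` of `Γ(V, Ω¹)` over `Γ(X, V)` indexed by `ι` (`V` affine) gives the basis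
`{b_J = ∧_{j ∈ J} b_j}` of `Γ(V, Ωᵃ) ≅ ⋀ᵃ Γ(V, Ω¹)` indexed by the `a`-element subsets `J ⊆ ι`
(Mathlib's `Module.Basis.exteriorPower`, transported along the bijective sheafification map
`bijective_toHodgeSheaf_app`; Hartshorne, *Algebraic Geometry*, II Ex. 5.16). [folklore] -/
theorem nonempty_basis_sections_hodgeSheaf (hV : IsAffineOpen V) {ι : Type u}
    (b : Module.Basis ι Γ(X.left, V) Γ(cotangentSheaf X, V)) :
    Nonempty (Module.Basis (Set.powersetCard ι a) Γ(X.left, V) Γ(hodgeSheaf X a, V)) := by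
  classical
  letI : LinearOrder ι := linearOrderOfSTO WellOrderingRel
  -- the sheafification map `φ`, bijective on affine opens where `Ω¹` is free
  obtain ⟨φ, hφ⟩ : ∃ φ : exteriorPowerPresheaf (cotangentSheaf X).val a ⟶
      (PresheafOfModules.restrictScalars (𝟙 X.left.ringCatSheaf.obj)).obj (hodgeSheaf X a).val,
      ∀ ⦃U : X.left.Opens⦄, IsAffineOpen U → Module.Free Γ(X.left, U) Γ(cotangentSheaf X, U) →
        Function.Bijective (φ.app (op U)) :=
    ⟨_, fun U hU hF => bijective_toHodgeSheaf_app X a hU hF⟩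
  let l : (exteriorPowerPresheaf (cotangentSheaf X).val a).obj (op V) →ₗ[Γ(X.left, V)]
      Γ(hodgeSheaf X a, V) := (φ.app (op V)).hom
  let bV : Module.Basis (Set.powersetCard ι a) Γ(X.left, V)
      ((exteriorPowerPresheaf (cotangentSheaf X).val a).obj (op V)) := b.exteriorPower a
  exact ⟨bV.map (LinearEquiv.ofBijective l (hφ hV (Module.Free.of_basis b)))⟩

/-- A basis of `Γ(M, V)` over `Γ(Y, V)` transfers to a basis of the `Γ(Y, V)`-module of global
sections of `M` restricted to `Spec Γ(Y, V)`, i.e. `Γ(M, fromSpec(Spec Γ(Y, V)))` (the module to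
which the `~` construction is applied): restriction along the equality `fromSpec(Spec Γ(Y, V)) = V`
is a `Γ(Y, V)`-linear isomorphism (as in `free_sections_restrict_fromSpec`). [folklore] -/
theorem nonempty_basis_sections_restrict_fromSpec {Y : Scheme.{u}} {V : Y.Opens}
    (hV : IsAffineOpen V) (M : Y.Modules) {ι : Type u} (b : Module.Basis ι Γ(Y, V) Γ(M, V)) :
    Nonempty (Module.Basis ι Γ(Y, V)
      ((modulesSpecToSheaf.obj (M.restrict hV.fromSpec)).presheaf.obj (op ⊤))) := by
  let e : Γ(M, V) ≃ₗ[Γ(Y, V)] Γ(M.restrict hV.fromSpec, ⊤) :=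
    { (M.presheaf.mapIso (eqToIso (fromSpec_image_top hV)).op).addCommGroupIsoToAddEquiv with
      map_smul' := fun r x => by
        change M.presheaf.map (eqToHom (fromSpec_image_top hV)).op (r • x) =
          r • (show Γ(M.restrict hV.fromSpec, ⊤) from M.presheaf.map _ x)
        rw [restrict_fromSpec_smul_def, eqToHom_op,
          opens_op_hom_ext (eqToHom _) (homOfLE (fromSpec_image_le hV ⊤)).op]
        exact M.map_smul (homOfLE (fromSpec_image_le hV ⊤)) r x }
  exact ⟨b.map e⟩

/-- If `Γ(V, Ω¹_{X/k})` has a basis indexed by `ι` over `Γ(X, V)` (`V` affine), then the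
restriction of `Ωᵃ_{X/k}` to `Spec Γ(X, V)` is free on the `a`-element subsets of `ι`:
`Ωᵃ|_{Spec B} ≅ (B^{(C(ι,a))})~ ≅ 𝒪^{(C(ι,a))}` (Hartshorne, *Algebraic Geometry*, II Prop. 5.2(c)
and Ex. 5.16(a); Mathlib `tildeFinsupp`). [cite: Hartshorne1977, II Ex. 5.16(a)] -/
theorem nonempty_free_iso_hodgeSheaf_restrict (hV : IsAffineOpen V) {ι : Type u}
    (b : Module.Basis ι Γ(X.left, V) Γ(cotangentSheaf X, V)) :
    Nonempty (SheafOfModules.free (Set.powersetCard ι a) ≅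
      (hodgeSheaf X a).restrict hV.fromSpec) := by
  haveI := isIso_fromTildeΓ_hodgeSheaf_restrict X a hV (Module.Free.of_basis b)
  obtain ⟨bV⟩ := nonempty_basis_sections_hodgeSheaf X a hV b
  obtain ⟨bΓ⟩ := nonempty_basis_sections_restrict_fromSpec hV (hodgeSheaf X a) bV
  let N := (hodgeSheaf X a).restrict hV.fromSpec
  exact ⟨(tildeFinsupp _).symm ≪≫ (tilde.functor _).mapIso bΓ.repr.toModuleIso.symm ≪≫
    asIso N.fromTildeΓ⟩

end HodgeRestrictSpec

/-! ### Smoothness of relative dimension `d` gives `Γ(V, Ω¹) ≅ 𝒪(V)^d` on small affine opens -/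

section Smooth

-- `TopCat.Presheaf`/`TopCat.Sheaf` are not reducible: as in Mathlib's `AlgebraicGeometry.Modules`.
set_option backward.isDefEq.respectTransparency false

variable {k : Type u} [CommRing k] (X : Over (Spec (CommRingCat.of k)))

/-- If `k → Γ(X, V)` is standard smooth of relative dimension `d` (for the `k`-algebra structure
of the `k`-scheme `X`) on a nonempty affine open `V`, then `Γ(V, Ω¹_{X/k}) ≅ Ω_{Γ(X,V)/k}` is a
free `Γ(X, V)`-module of rank `d` (Stacks 00T7 (2),(3): `Ω_{S/R}` is free of rank the relative
dimension of a standard smooth `R → S`; Mathlib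
`IsStandardSmoothOfRelativeDimension.rank_kaehlerDifferential`; and `Γ(V, Ω¹_{X/k}) ≅ Ω_{Γ(X,V)/k}`,
Hartshorne, *Algebraic Geometry*, II Rem. 8.9.2, `bijective_toCotangentSheaf_app_holds`).
[cite: StacksProject, Tag 00T7] -/
theorem exists_basis_sections_cotangentSheaf_of_isStandardSmoothOfRelativeDimension (d : ℕ)
    {V : X.left.Opens} (hV : IsAffineOpen V) [Nontrivial Γ(X.left, V)]
    (h : ((constToPresheaf X).app (op V)).hom.IsStandardSmoothOfRelativeDimension d) :
    ∃ ι : Type u, Finite ι ∧ Nat.card ι = d ∧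
      Nonempty (Module.Basis ι Γ(X.left, V) Γ(cotangentSheaf X, V)) := by
  letI algV : Algebra k Γ(X.left, V) := (((constToPresheaf X).app (op V)).hom).toAlgebra
  haveI : Algebra.IsStandardSmoothOfRelativeDimension d k Γ(X.left, V) := h
  haveI : Algebra.IsStandardSmooth k Γ(X.left, V) :=
    Algebra.IsStandardSmoothOfRelativeDimension.isStandardSmooth d
  haveI : Algebra.FinitePresentation k Γ(X.left, V) :=
    Algebra.IsStandardSmooth.finitePresentation
  have hrank : Module.rank Γ(X.left, V) Ω[Γ(X.left, V)⁄k] = d :=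
    Algebra.IsStandardSmoothOfRelativeDimension.rank_kaehlerDifferential d
  have hfin : Module.finrank Γ(X.left, V) ((kaehlerPresheaf X).obj (op V)) = d :=
    Module.finrank_eq_of_rank_eq hrank
  haveI : Module.Free Γ(X.left, V) ((kaehlerPresheaf X).obj (op V)) :=
    inferInstanceAs (Module.Free Γ(X.left, V) Ω[Γ(X.left, V)⁄k])
  haveI : Module.Finite Γ(X.left, V) ((kaehlerPresheaf X).obj (op V)) :=
    inferInstanceAs (Module.Finite Γ(X.left, V) Ω[Γ(X.left, V)⁄k])
  let bΩ : Module.Basis (Fin d) Γ(X.left, V) ((kaehlerPresheaf X).obj (op V)) :=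
    Module.finBasisOfFinrankEq _ _ hfin
  let l : (kaehlerPresheaf X).obj (op V) →ₗ[Γ(X.left, V)] Γ(cotangentSheaf X, V) :=
    ((toCotangentSheaf X).app (op V)).hom
  refine ⟨ULift.{u} (Fin d), inferInstance, by simp, ⟨?_⟩⟩
  exact (bΩ.map (LinearEquiv.ofBijective l (bijective_toCotangentSheaf_app_holds X hV))).reindex
    Equiv.ulift.symm

/-- Around every point of a `k`-scheme smooth of relative dimension `d` there is an affine open `V`
with `Γ(V, Ω¹_{X/k})` free of rank `d` over `Γ(X, V)`: on an affine open neighbourhood `U`, the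
ring map `k → Γ(X, U)` is locally standard smooth of relative dimension `d` (Mathlib:
`SmoothOfRelativeDimension d` has the ring-hom property
`Locally (IsStandardSmoothOfRelativeDimension d)`), i.e. `k → Γ(X, U)_t = Γ(X, D(t))` is standard
smooth of relative dimension `d` for `t` in a set generating the unit ideal, so some `D(t) ∋ x`
will do. (Stacks 02G1: `Ω_{X/S}` is finite locally free of rank `dim_x X_{f(x)}`.)
[cite: StacksProject, Tag 02G1] -/
theorem exists_basis_sections_cotangentSheaf (d : ℕ) [SmoothOfRelativeDimension d X.hom]
    (x : X.left) :
    ∃ V : X.left.Opens, IsAffineOpen V ∧ x ∈ V ∧ ∃ ι : Type u, Finite ι ∧ Nat.card ι = d ∧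
      Nonempty (Module.Basis ι Γ(X.left, V) Γ(cotangentSheaf X, V)) := by
  obtain ⟨U, hU, hxU, -⟩ := exists_isAffineOpen_mem_and_subset (U := ⊤) (Set.mem_univ x)
  have hloc := HasRingHomProperty.appLE (@SmoothOfRelativeDimension d) X.hom ‹_›
    ⟨⊤, isAffineOpen_top _⟩ ⟨U, hU⟩ le_top
  obtain ⟨s, hs, hst⟩ := (RingHom.locally_iff_isLocalization
    RingHom.isStandardSmoothOfRelativeDimension_respectsIso _).mp hloc
  obtain ⟨⟨t, ht⟩, hxt⟩ := Opens.mem_iSup.mp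
    (hU.self_le_iSup_basicOpen_iff.mpr (by exact_mod_cast hs) hxU)
  refine ⟨X.left.basicOpen t, hU.basicOpen t, hxt, ?_⟩
  haveI : Nonempty (X.left.basicOpen t) := ⟨⟨x, hxt⟩⟩
  apply exists_basis_sections_cotangentSheaf_of_isStandardSmoothOfRelativeDimension X d
    (hU.basicOpen t)
  haveI := hU.isLocalization_basicOpen t
  have hfg : ((constToPresheaf X).app (op (X.left.basicOpen t))).hom =
      (algebraMap Γ(X.left, U) Γ(X.left, X.left.basicOpen t)).comp
        ((constToPresheaf X).app (op U)).hom := by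
    ext r
    have h := CategoryTheory.congr_fun
      ((constToPresheaf X).naturality (homOfLE (X.left.basicOpen_le t)).op) r
    simp only [Functor.const_obj_map, CommRingCat.comp_apply] at h
    exact h
  have h1 : ((constToPresheaf X).app (op U)).hom = (X.hom.appLE ⊤ U le_top).hom.comp
      (Scheme.ΓSpecIso (CommRingCat.of k)).commRingCatIsoToRingEquiv.symm.toRingHom :=
    RingHom.ext fun r => rfl
  rw [hfg, h1, ← RingHom.comp_assoc]
  exact RingHom.isStandardSmoothOfRelativeDimension_respectsIso.2 _ _
    (hst t ht Γ(X.left, X.left.basicOpen t))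

end Smooth

/-! ### The discharge -/

section Assembly

-- `TopCat.Presheaf`/`TopCat.Sheaf` are not reducible: as in Mathlib's `AlgebraicGeometry.Modules`.
set_option backward.isDefEq.respectTransparency false

open SheafOfModules

variable {k : Type u} [CommRing k] (X : Over (Spec (CommRingCat.of k)))

/-- **Discharge of `hasRank_hodgeSheaf_choose`** (Hartshorne, *Algebraic Geometry*, II Ex. 5.16(a):
if `ℱ` is locally free of rank `n` then `⋀ʳ ℱ` is locally free of rank `C(n, r)`; with II Thm. 8.15
/ III Prop. 10.4 / Stacks 02G1: `Ω_{X/k}` is locally free of rank `d` for `X → Spec k` smooth of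
relative dimension `d`): for every `a`, the Hodge sheaf `Ωᵃ_{X/k} = ⋀ᵃ Ω¹_{X/k}` admits local
generators data which are locally free data with `C(d, a)` generators on each member of the cover.
Proof: around each point an affine open `V` with `Γ(V, Ω¹)` free on `ι`, `#ι = d` (smooth ⇒ locally
standard smooth of relative dimension `d`, Stacks 00T7); then `Γ(U, Ωᵃ) = ⋀ᵃ Γ(U, Ω¹)` on the
affine opens where `Ω¹` is free (exterior powers commute with localization; Hartshorne II.5.1),
`Ωᵃ|_{Spec Γ(X,V)}` is localizing hence `≅ (⋀ᵃ Γ(V, Ω¹))~ ≅ 𝒪^{(C(ι,a))}` (II Cor. 5.5; the basis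
`b_J` of `⋀ᵃ` of a free module); transport to the over-site of `V`
(`nonempty_free_iso_over_of_free_iso_restrict`) and assemble `LocalGeneratorsData` indexed by the
points of `X`. [cite: Hartshorne1977, II Ex. 5.16(a) and II Thm. 8.15] -/
theorem hasRank_hodgeSheaf_choose_holds : hasRank_hodgeSheaf_choose X := by
  intro d _ a
  choose V hV hxV ι hfin hcard hb using fun x => exists_basis_sections_cotangentSheaf X d x
  have hcov : (Opens.grothendieckTopology X.left).CoversTop V :=
    (Opens.coversTop_iff _ V).mpr
      (TopologicalSpace.IsOpenCover.mk (top_le_iff.mp fun y _ => Opens.mem_iSup.mpr ⟨y, hxV y⟩))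
  have e' : ∀ y, free (Set.powersetCard (ι y) a) ≅ (hodgeSheaf X a).over (V y) := fun y =>
    (nonempty_free_iso_over_of_free_iso_restrict (hV y) (hodgeSheaf X a)
      (nonempty_free_iso_hodgeSheaf_restrict X a (hV y) (hb y).some).some).some
  let q : LocalGeneratorsData (R := X.left.ringCatSheaf) (hodgeSheaf X a) :=
    { I := X.left
      X := V
      coversTop := hcov
      generators := fun y => (free.generatingSections (Set.powersetCard (ι y) a)).ofEpi (e' y).hom }
  have hq : ∀ y, IsIso ((free.generatingSections
      (Set.powersetCard (ι y) a)).ofEpi (e' y).hom).π := fun y => by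
    rw [GeneratingSections.ofEpi_π]
    infer_instance
  haveI hq' : q.IsLocallyFreeData := LocalGeneratorsData.IsLocallyFreeData.mk (q := q) hq
  refine ⟨q, hq', fun y => ⟨?_, ?_⟩⟩
  · haveI := hfin y
    change Finite (Set.powersetCard (ι y) a)
    infer_instance
  · change Nat.card (Set.powersetCard (ι y) a) = d.choose a
    rw [Set.powersetCard.card, hcard y]

end Assembly

end Literature.AlgebraicGeometry.Motives
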